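import Mathlib
import HarnessLib
import Summits.HubbardSuperconductivity.HubbardSuperconductivity.Theorems.KLProgrammeC4aPPKernelSplitFactor

/-!
# Route `KLProgramme` — crux C4a, S3 brick (B4) «(B4)-UMK1», «(M1)-K2-PACKAGE» part 2: the ONE-SIDED SPLIT KERNEL `K⁺(e,u) = N(e,u)·κ(e/(e+u))/(e+u)` (`u > 0`),
# `0` (`u ≤ 0`) — definition, vanishing below the threshold, two layers of partner derivatives, `C²`

Cell `gate-hubbard-kl`, seat hubbard-kl-k3c3-p1 (g16; row «δμ-flow with klAngularMean constant piece»).  Located brick for the (U1) chain of hubbard-kl-k3c3-p3 (the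
positive-level `hpre` law `…C4aFoldBoxPreLaw.intervalIntegral_partnerBand_pre_le`: rows `hK : ContDiff ℝ 2 (Kr e)`, `hK1`, `hK2 : |iteratedDeriv 2 (Kr e) u| ≤ (max e |u|)⁻¹³`,
`hsupp : u ≤ q_s·e ⇒ deriv (Kr e) u = 0`, `hKc : Continuous fun p ↦ deriv (Kr p.1) p.2`) / the (C)-closer lane (stub (C) `stub_twoLeg_curvature` of `KLRegimeEngineV17F2`,
stmt-HubbardSuperconductivity-20437); part 1 = `…C4aPPKernelSplitFactor` (the `R`-calculus), part 3 = `…C4aPPKernelOneSidedRows` (the rows `hK0/hK1/hK2/hsupp/hKc`);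
memo HOME/hubbard-kl-k3c3-p1/g16-M1-NEG-PRE-KERNEL.md §5.

THE OBJECT.  `ppOneSidedKernel β Λ κ e u = N(e,u)·κ(e/(e+u))/(e+u)` for `u > 0` and `0` for `u ≤ 0` (`N = ppTrueNumerator`, the g15 true numerator; `κ` the finer-line
split profile: `C²` via `HasDerivAt κ κ′`, `HasDerivAt κ′ κ″`, `κ″` continuous; `κ = κ′ = κ″ = 0` on `[t₁,∞)`, `0 < t₁ < 1`).  For `e > 0` it VANISHES for
`u ≤ e(1−t₁)/t₁` (below `0` by definition, on `(0, e(1−t₁)/t₁]` because `e/(e+u) ≥ t₁`), and equals the smooth `N·R` on `u > 0`; the open sets `{u < e(1−t₁)/t₁}`,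
`{u > 0}` cover `ℝ`, so `K⁺` is `C²` with `K⁺′ = N′R + NR′`, `K⁺″ = N″R + 2N′R′ + NR″` on `u > 0` (`ppOneSidedKernelD1/D2`) and `0` below.  On every pre-side partner
line (`u ≥ D − 3e/2 ≥ −3e/2`) `K⁺` coincides with the two-sided split kernel `P·κ(e/(e+|u|))` iff `t₁ ≤ 2/5` — the closer's (B3) identification; these files only
supply the analytic rows.
* **`ppOneSidedKernel(_D1/_D2)_eq_zero_of_le`** (vanishing for `u ≤ e(1−t₁)/t₁`), **`hasDerivAt_ppOneSidedKernel`**, **`hasDerivAt_ppOneSidedKernelD1`** (everywhere),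
  **`continuous_ppOneSidedKernelD2`**, **`contDiff_two_ppOneSidedKernel`** (ROW `hK`), `deriv_ppOneSidedKernel`, `iteratedDeriv_two_ppOneSidedKernel`.
Pure real analysis on Literature objects; nothing asserts (C), K3, the window or superconductivity.
References: BGM 2006 §2.4 (2.36) [cite: BenfattoGiulianiMastropietro2006]; Salmhofer 1999 §4.2.5 (4.70)–(4.71) [cite: Salmhofer1999];
FST II CPAM 51 (1998) §3 [cite: FeldmanSalmhoferTrubowitz1998].
-/

noncomputable section

namespace Summit.HubbardSuperconductivity.HubbardSuperconductivity.Theorems.C4a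

set_option linter.dupNamespace false -- summit = problem name (single-conjunct summit), D-0017

open Real Filter Set
open scoped Topology
open Literature.MathematicalPhysics.QuantumLattice Literature.Analysis.SpecialFunctions

/-! ## §1 The one-sided split kernel: definition, vanishing, two derivatives, `C²` -/

/-- **The one-sided split kernel** `K⁺(e,u) = N(e,u)·κ(e/(e+u))/(e+u)` for `u > 0`, `0` for `u ≤ 0`. -/
def ppOneSidedKernel (β Λ : ℝ) (κ : ℝ → ℝ) (e u : ℝ) : ℝ :=
  if 0 < u then ppTrueNumerator β Λ e u * (κ (e / (e + u)) / (e + u)) else 0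

/-- Its partner derivative `K⁺′ = N′R + NR′` on `u > 0`, `0` on `u ≤ 0`. -/
def ppOneSidedKernelD1 (β Λ : ℝ) (κ κ' : ℝ → ℝ) (e u : ℝ) : ℝ :=
  if 0 < u then
    ppTrueNumeratorDu β Λ e u * (κ (e / (e + u)) / (e + u)) +
      ppTrueNumerator β Λ e u * (-(κ' (e / (e + u)) * (e / (e + u)) + κ (e / (e + u))) / (e + u) ^ 2)
  else 0

/-- Its second partner derivative `K⁺″ = N″R + 2N′R′ + NR″` on `u > 0`, `0` on `u ≤ 0`. -/
def ppOneSidedKernelD2 (β Λ : ℝ) (κ κ' κ'' : ℝ → ℝ) (e u : ℝ) : ℝ :=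
  if 0 < u then
    ppTrueNumeratorDuu β Λ e u * (κ (e / (e + u)) / (e + u)) +
      2 * ppTrueNumeratorDu β Λ e u * (-(κ' (e / (e + u)) * (e / (e + u)) + κ (e / (e + u))) / (e + u) ^ 2) +
      ppTrueNumerator β Λ e u *
        ((κ'' (e / (e + u)) * (e / (e + u)) ^ 2 + 4 * κ' (e / (e + u)) * (e / (e + u)) + 2 * κ (e / (e + u))) / (e + u) ^ 3)
  else 0

section Kernel

variable {β Λ : ℝ} (hβ : 0 < β) (hΛ : 0 < Λ) {B₁ B₂ : ℝ} (hB₁ : ∀ x, |deriv salmhoferCutoff x| ≤ B₁) (hB₂ : ∀ x, |deriv (deriv salmhoferCutoff) x| ≤ B₂)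
  {κ κ' κ'' : ℝ → ℝ} (hκ : ∀ t, HasDerivAt κ (κ' t) t) (hκ' : ∀ t, HasDerivAt κ' (κ'' t) t) (hκ''c : Continuous κ'')
  {t₁ : ℝ} (ht₀ : 0 < t₁) (ht₁ : t₁ < 1) (hκs : ∀ t, t₁ ≤ t → κ t = 0) (hκ's : ∀ t, t₁ ≤ t → κ' t = 0) (hκ''s : ∀ t, t₁ ≤ t → κ'' t = 0)
  {e : ℝ} (he : 0 < e)

include ht₀ hκs he in
/-- **Vanishing below the threshold**: `u ≤ e(1−t₁)/t₁ ⟹ K⁺(e,u) = 0`. [folklore] -/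
theorem ppOneSidedKernel_eq_zero_of_le {u : ℝ} (hu : u ≤ e * (1 - t₁) / t₁) : ppOneSidedKernel β Λ κ e u = 0 := by
  unfold ppOneSidedKernel
  by_cases h0 : 0 < u
  · rw [if_pos h0, hκs _ (splitRatio_ge_of_le ht₀ (by linarith) hu)]; simp
  · rw [if_neg h0]

include ht₀ hκs hκ's he in
/-- `u ≤ e(1−t₁)/t₁ ⟹ K⁺′(e,u) = 0`. [folklore] -/
theorem ppOneSidedKernelD1_eq_zero_of_le {u : ℝ} (hu : u ≤ e * (1 - t₁) / t₁) : ppOneSidedKernelD1 β Λ κ κ' e u = 0 := by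
  unfold ppOneSidedKernelD1
  by_cases h0 : 0 < u
  · have ha := splitRatio_ge_of_le ht₀ (by linarith : -e < u) hu
    rw [if_pos h0, hκs _ ha, hκ's _ ha]; simp
  · rw [if_neg h0]

include ht₀ hκs hκ's hκ''s he in
/-- `u ≤ e(1−t₁)/t₁ ⟹ K⁺″(e,u) = 0`. [folklore] -/
theorem ppOneSidedKernelD2_eq_zero_of_le {u : ℝ} (hu : u ≤ e * (1 - t₁) / t₁) : ppOneSidedKernelD2 β Λ κ κ' κ'' e u = 0 := by
  unfold ppOneSidedKernelD2
  by_cases h0 : 0 < u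
  · have ha := splitRatio_ge_of_le ht₀ (by linarith : -e < u) hu
    rw [if_pos h0, hκs _ ha, hκ's _ ha, hκ''s _ ha]; simp
  · rw [if_neg h0]

include ht₀ ht₁ he in
/-- The threshold is positive: `0 < e(1−t₁)/t₁`. [folklore] -/
theorem oneSided_threshold_pos : 0 < e * (1 - t₁) / t₁ := by
  have : 0 < 1 - t₁ := by linarith
  positivity

include hβ hΛ hB₁ hκ ht₀ ht₁ hκs he in
/-- **`∂ᵤK⁺ = K⁺′` everywhere.** [cite: BenfattoGiulianiMastropietro2006, §2.4 (2.36)] -/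
theorem hasDerivAt_ppOneSidedKernel (u : ℝ) :
    HasDerivAt (fun v : ℝ => ppOneSidedKernel β Λ κ e v) (ppOneSidedKernelD1 β Λ κ κ' e u) u := by
  by_cases h0 : 0 < u
  · -- on the open half line `u > 0`, `K⁺ = N·R`
    have hs : e + u ≠ 0 := by linarith
    have hN := hasDerivAt_ppTrueNumerator_u hβ hΛ hB₁ e u
    have hR := hasDerivAt_splitR hκ hs
    have h := hN.mul hR
    have hev : (fun v : ℝ => ppOneSidedKernel β Λ κ e v) =ᶠ[𝓝 u] fun v => ppTrueNumerator β Λ e v * (κ (e / (e + v)) / (e + v)) := by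
      filter_upwards [Ioi_mem_nhds h0] with v hv
      unfold ppOneSidedKernel; rw [if_pos (mem_Ioi.1 hv)]
    refine (h.congr_of_eventuallyEq hev).congr_deriv ?_
    unfold ppOneSidedKernelD1; rw [if_pos h0]
  · -- below `0`: locally zero
    have hthr := oneSided_threshold_pos ht₀ ht₁ he
    have hev : (fun v : ℝ => ppOneSidedKernel β Λ κ e v) =ᶠ[𝓝 u] fun _ => (0 : ℝ) := by
      filter_upwards [Iio_mem_nhds (show u < e * (1 - t₁) / t₁ by linarith)] with v hv
      exact ppOneSidedKernel_eq_zero_of_le ht₀ hκs he (le_of_lt hv)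
    refine ((hasDerivAt_const u (0 : ℝ)).congr_of_eventuallyEq hev).congr_deriv ?_
    unfold ppOneSidedKernelD1; rw [if_neg h0]

include hβ hΛ hB₁ hB₂ hκ hκ' ht₀ ht₁ hκs hκ's he in
/-- **`∂ᵤK⁺′ = K⁺″` everywhere.** [cite: BenfattoGiulianiMastropietro2006, §2.4 (2.36)] -/
theorem hasDerivAt_ppOneSidedKernelD1 (u : ℝ) :
    HasDerivAt (fun v : ℝ => ppOneSidedKernelD1 β Λ κ κ' e v) (ppOneSidedKernelD2 β Λ κ κ' κ'' e u) u := by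
  by_cases h0 : 0 < u
  · have hs : e + u ≠ 0 := by linarith
    have hN := hasDerivAt_ppTrueNumerator_u hβ hΛ hB₁ e u
    have hN' := hasDerivAt_ppTrueNumeratorDu_u hβ hΛ hB₁ hB₂ e u
    have hR := hasDerivAt_splitR hκ hs
    have hR' := hasDerivAt_splitR1 hκ hκ' hs
    have h := (hN'.mul hR).add (hN.mul hR')
    have hev : (fun v : ℝ => ppOneSidedKernelD1 β Λ κ κ' e v) =ᶠ[𝓝 u] fun v =>
        ppTrueNumeratorDu β Λ e v * (κ (e / (e + v)) / (e + v)) +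
          ppTrueNumerator β Λ e v * (-(κ' (e / (e + v)) * (e / (e + v)) + κ (e / (e + v))) / (e + v) ^ 2) := by
      filter_upwards [Ioi_mem_nhds h0] with v hv
      unfold ppOneSidedKernelD1; rw [if_pos (mem_Ioi.1 hv)]
    refine (h.congr_of_eventuallyEq hev).congr_deriv ?_
    unfold ppOneSidedKernelD2; rw [if_pos h0]
    ring
  · have hthr := oneSided_threshold_pos ht₀ ht₁ he
    have hev : (fun v : ℝ => ppOneSidedKernelD1 β Λ κ κ' e v) =ᶠ[𝓝 u] fun _ => (0 : ℝ) := by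
      filter_upwards [Iio_mem_nhds (show u < e * (1 - t₁) / t₁ by linarith)] with v hv
      exact ppOneSidedKernelD1_eq_zero_of_le ht₀ hκs hκ's he (le_of_lt hv)
    refine ((hasDerivAt_const u (0 : ℝ)).congr_of_eventuallyEq hev).congr_deriv ?_
    unfold ppOneSidedKernelD2; rw [if_neg h0]

include hβ hΛ hB₁ hB₂ hκ hκ' hκ''c ht₀ ht₁ hκs hκ's hκ''s he in
/-- **`K⁺″` is continuous in the partner level.** [cite: BenfattoGiulianiMastropietro2006, §2.4 (2.36)] -/
theorem continuous_ppOneSidedKernelD2 : Continuous fun v : ℝ => ppOneSidedKernelD2 β Λ κ κ' κ'' e v := by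
  have hκc : Continuous κ := continuous_iff_continuousAt.2 fun t => (hκ t).continuousAt
  have hκ'c : Continuous κ' := continuous_iff_continuousAt.2 fun t => (hκ' t).continuousAt
  refine continuous_iff_continuousAt.2 fun u => ?_
  by_cases h0 : 0 < u
  · have hs : e + u ≠ 0 := by linarith
    have hN : ContinuousAt (fun v : ℝ => ppTrueNumerator β Λ e v) u := (continuous_ppTrueNumerator_comp hβ Λ continuous_const continuous_id).continuousAt
    have hN' : ContinuousAt (fun v : ℝ => ppTrueNumeratorDu β Λ e v) u :=
      (continuous_ppTrueNumeratorDu_comp hβ hΛ hB₁ continuous_const continuous_id).continuousAt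
    have hN'' : ContinuousAt (fun v : ℝ => ppTrueNumeratorDuu β Λ e v) u := (continuous_ppTrueNumeratorDuu_u hβ hΛ hB₁ hB₂ e).continuousAt
    have hR : ContinuousAt (fun v : ℝ => κ (e / (e + v)) / (e + v)) u := (hasDerivAt_splitR hκ hs).continuousAt
    have hR' : ContinuousAt (fun v : ℝ => -(κ' (e / (e + v)) * (e / (e + v)) + κ (e / (e + v))) / (e + v) ^ 2) u := (hasDerivAt_splitR1 hκ hκ' hs).continuousAt
    have ha : ContinuousAt (fun v : ℝ => e / (e + v)) u := (hasDerivAt_splitRatio hs).continuousAt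
    have hκ''a : ContinuousAt (fun v : ℝ => κ'' (e / (e + v))) u := hκ''c.continuousAt.comp ha
    have hκ'a : ContinuousAt (fun v : ℝ => κ' (e / (e + v))) u := hκ'c.continuousAt.comp ha
    have hκa : ContinuousAt (fun v : ℝ => κ (e / (e + v))) u := hκc.continuousAt.comp ha
    have hR'' : ContinuousAt (fun v : ℝ =>
        (κ'' (e / (e + v)) * (e / (e + v)) ^ 2 + 4 * κ' (e / (e + v)) * (e / (e + v)) + 2 * κ (e / (e + v))) / (e + v) ^ 3) u := by
      refine ContinuousAt.div ?_ (by fun_prop) (pow_ne_zero 3 hs)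
      exact ((hκ''a.mul (ha.pow 2)).add ((continuousAt_const.mul hκ'a).mul ha)).add (continuousAt_const.mul hκa)
    have hG : ContinuousAt (fun v : ℝ =>
        ppTrueNumeratorDuu β Λ e v * (κ (e / (e + v)) / (e + v)) +
          2 * ppTrueNumeratorDu β Λ e v * (-(κ' (e / (e + v)) * (e / (e + v)) + κ (e / (e + v))) / (e + v) ^ 2) +
          ppTrueNumerator β Λ e v *
            ((κ'' (e / (e + v)) * (e / (e + v)) ^ 2 + 4 * κ' (e / (e + v)) * (e / (e + v)) + 2 * κ (e / (e + v))) / (e + v) ^ 3)) u :=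
      ((hN''.mul hR).add ((continuousAt_const.mul hN').mul hR')).add (hN.mul hR'')
    have hev : (fun v : ℝ => ppOneSidedKernelD2 β Λ κ κ' κ'' e v) =ᶠ[𝓝 u] fun v =>
        ppTrueNumeratorDuu β Λ e v * (κ (e / (e + v)) / (e + v)) +
          2 * ppTrueNumeratorDu β Λ e v * (-(κ' (e / (e + v)) * (e / (e + v)) + κ (e / (e + v))) / (e + v) ^ 2) +
          ppTrueNumerator β Λ e v *
            ((κ'' (e / (e + v)) * (e / (e + v)) ^ 2 + 4 * κ' (e / (e + v)) * (e / (e + v)) + 2 * κ (e / (e + v))) / (e + v) ^ 3) := by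
      filter_upwards [Ioi_mem_nhds h0] with v hv
      unfold ppOneSidedKernelD2; rw [if_pos (mem_Ioi.1 hv)]
    exact hG.congr_of_eventuallyEq hev
  · have hthr := oneSided_threshold_pos ht₀ ht₁ he
    have hev : (fun v : ℝ => ppOneSidedKernelD2 β Λ κ κ' κ'' e v) =ᶠ[𝓝 u] fun _ => (0 : ℝ) := by
      filter_upwards [Iio_mem_nhds (show u < e * (1 - t₁) / t₁ by linarith)] with v hv
      exact ppOneSidedKernelD2_eq_zero_of_le ht₀ hκs hκ's hκ''s he (le_of_lt hv)
    exact continuousAt_const.congr_of_eventuallyEq hev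

include hβ hΛ hB₁ hB₂ hκ hκ' hκ''c ht₀ ht₁ hκs hκ's hκ''s he in
/-- **ROW `hK`: `u ↦ K⁺(e,u)` is `C²`.** [cite: BenfattoGiulianiMastropietro2006, §2.4 (2.36)] -/
theorem contDiff_two_ppOneSidedKernel : ContDiff ℝ 2 (fun v : ℝ => ppOneSidedKernel β Λ κ e v) :=
  contDiff_two_of_hasDerivAt₂ (hasDerivAt_ppOneSidedKernel hβ hΛ hB₁ hκ ht₀ ht₁ hκs he)
    (hasDerivAt_ppOneSidedKernelD1 hβ hΛ hB₁ hB₂ hκ hκ' ht₀ ht₁ hκs hκ's he)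
    (continuous_ppOneSidedKernelD2 hβ hΛ hB₁ hB₂ hκ hκ' hκ''c ht₀ ht₁ hκs hκ's hκ''s he)

include hβ hΛ hB₁ hκ ht₀ ht₁ hκs he in
/-- `deriv K⁺(e,·) = K⁺′(e,·)`. [cite: BenfattoGiulianiMastropietro2006, §2.4 (2.36)] -/
theorem deriv_ppOneSidedKernel (u : ℝ) : deriv (fun v : ℝ => ppOneSidedKernel β Λ κ e v) u = ppOneSidedKernelD1 β Λ κ κ' e u :=
  (hasDerivAt_ppOneSidedKernel hβ hΛ hB₁ hκ ht₀ ht₁ hκs he u).deriv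

include hβ hΛ hB₁ hB₂ hκ hκ' ht₀ ht₁ hκs hκ's he in
/-- `iteratedDeriv 2 K⁺(e,·) = K⁺″(e,·)`. [cite: BenfattoGiulianiMastropietro2006, §2.4 (2.36)] -/
theorem iteratedDeriv_two_ppOneSidedKernel (u : ℝ) :
    iteratedDeriv 2 (fun v : ℝ => ppOneSidedKernel β Λ κ e v) u = ppOneSidedKernelD2 β Λ κ κ' κ'' e u := by
  have hd : deriv (fun v : ℝ => ppOneSidedKernel β Λ κ e v) = fun v => ppOneSidedKernelD1 β Λ κ κ' e v :=
    funext fun v => deriv_ppOneSidedKernel hβ hΛ hB₁ hκ ht₀ ht₁ hκs he v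
  rw [iteratedDeriv_succ, iteratedDeriv_one, hd]
  exact (hasDerivAt_ppOneSidedKernelD1 hβ hΛ hB₁ hB₂ hκ hκ' ht₀ ht₁ hκs hκ's he u).deriv

end Kernel

end Summit.HubbardSuperconductivity.HubbardSuperconductivity.Theorems.C4a

end
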